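import Mathlib
import HarnessLib
import HarnessLib.Audit
import Summits.NavierStokesRegularity.Statement
import Literature.Analysis.FluidPDE.ClassicalSolution
import Literature.Analysis.FluidPDE.LerayHopf
import Literature.Analysis.FluidPDE.SelfSimilar
import Literature.Analysis.FluidPDE.VectorCalculus
import Literature.Analysis.FluidPDE.NSWave0
import Summits.NavierStokesRegularity.NavierStokesRegularity.Theorems.TypeICertificateLadderNoBlowupToClay
import Summits.NavierStokesRegularity.NavierStokesRegularity.Theorems.ContinuousAlignmentNoBlowupToClay
import HarnessLib.Audit.Status.Attr

/-!
Route: SlicedKelvin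

DORMANT since 2026-09-01T14:01:30Z (reconciler: no traction for 5 d (last activity statement-closed at 2026-08-27T12:56:20Z); parked, not closed — `ledger route dormant route-NavierStokesRegularity-SlicedKelvin --off` to reactivate) — unstaffed, not closed; items shared with open routes are served there. `ledger route dormant <id> --off` reactivates.

# Route SlicedKelvin — Kelvin sliced by planes — an a-priori bound on unsigned planar vorticity flux
(fold law) plus Liouville at bounded flux

X = PlanarFluxAPriori ∧ BoundedFluxNoBlowup ("it suffices to show"; realises card
planar-fold-law-unsigned-flux (spine, critic-graded new-mechanism) and, for the zoom half, card
circulation-density-liouville). OBJECT: the UNSIGNED VORTICITY FLUX through a fixed plane Π = R({x₂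
= c}) (R a linear isometry, unit normal n = R e₂): Φ(u;t,R,c) := ∫_Π |ω(t)·n| dA, ω = curl u(t) —
critical (invariant under u ↦ λu(λx,λ²t)), with the dimension of a circulation; ∫Φ dc = ‖ω·n‖_{L¹}
is a-priori bounded (Constantin1990), so the whole question is sup over planes. PlanarFluxAPriori
(crux 2): along every classical Leray–Hopf solution from a rapidly decaying datum on [0,T) the
planar flux stays bounded over all planes and times. BoundedFluxNoBlowup: a solution of that class
whose planar flux stays bounded extends smoothly past T — RATE-FREE, reached as PlanarFluxLiouville
(crux 3: a smooth bounded ancient mild solution with bounded planar flux is slice-wise constant) +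
FluxZoom (crux 4: Biot–Savart gives ‖u‖²_∞ ≲ ‖ω‖_∞·sup Φ, so at bounded flux the
VORTICITY-normalised KNSS zoom is velocity-bounded and converges to a NON-CONSTANT bounded ancient
mild solution inheriting the flux bound). FluxDataBound (support) is the quantitative, falsifiable
form of crux 2 (bound uniform in energy, L¹-vorticity and initial flux of the datum).
Lean: `(∀ (ν T : ℝ), 0 < ν → 0 < T → ∀ (u : ℝ → EuclideanSpace ℝ (Fin 3) → EuclideanSpace ℝ (Fin 3))
(p : ℝ → EuclideanSpace ℝ (Fin 3) → ℝ), Literature.Analysis.FluidPDE.IsClassicalNSSolutionOn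
(Set.Ico 0 T) ν 0 u p → Literature.Analysis.FluidPDE.IsLerayHopfOn T ν 0 (u 0) u →
Literature.Analysis.FluidPDE.HasRapidSpatialDecay (u 0) → ∃ M : ℝ, ∀ t ∈ Set.Ico 0 T, ∀ (R :
EuclideanSpace ℝ (Fin 3) ≃ₗᵢ[ℝ] EuclideanSpace ℝ (Fin 3)) (c : ℝ), ∫⁻ y : EuclideanSpace ℝ (Fin 2),
‖inner ℝ (Literature.Analysis.FluidPDE.curl (u t) (R (WithLp.toLp 2 ![y 0, y 1, c]))) (R
(EuclideanSpace.single 2 1))‖ₑ ≤ ENNReal.ofReal M) ∧ (∀ (ν T : ℝ), 0 < ν → 0 < T → ∀ (u : ℝ →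
EuclideanSpace ℝ (Fin 3) → EuclideanSpace ℝ (Fin 3)) (p : ℝ → EuclideanSpace ℝ (Fin 3) → ℝ),
Literature.Analysis.FluidPDE.IsClassicalNSSolutionOn (Set.Ico 0 T) ν 0 u p →
Literature.Analysis.FluidPDE.IsLerayHopfOn T ν 0 (u 0) u →
Literature.Analysis.FluidPDE.HasRapidSpatialDecay (u 0) → (∃ M : ℝ, ∀ t ∈ Set.Ico 0 T, ∀ (R :
EuclideanSpace ℝ (Fin 3) ≃ₗᵢ[ℝ] EuclideanSpace ℝ (Fin 3)) (c : ℝ), ∫⁻ y : EuclideanSpace ℝ (Fin 2),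
‖inner ℝ (Literature.Analysis.FluidPDE.curl (u t) (R (WithLp.toLp 2 ![y 0, y 1, c]))) (R
(EuclideanSpace.single 2 1))‖ₑ ≤ ENNReal.ofReal M) →
Literature.Analysis.FluidPDE.HasSmoothExtensionPast ν 0 u T)`

## Assembly
Pure logic, certified in the planner's Sketch.lean (theorem closes, lean check rc 0, 0 sorry): fix
ν, T, (u,p) classical on [0,T), Leray–Hopf from a rapidly decaying datum; PlanarFluxAPriori gives a
flux bound M on [0,T); if u had no smooth extension past T, FluxZoom would produce a smooth bounded
ancient mild solution with bounded planar flux that is non-constant on some slice, contradicting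
PlanarFluxLiouville; hence u extends past T (NoBlowup), and NoBlowupToClay (stmt-0055, proved) gives
NavierStokesRegularity. Deciding theorem (rev 3, CRUX-ONLY, native OK): `theorem closes (h₁ :
PlanarFluxAPriori) (h₂ : PlanarFluxLiouville) (h₃ : FluxZoom) : NavierStokesRegularity`, with
NoBlowupToClay (stmt-0055) not assumed but INVOKED inside the proof as the proved theorem
Theorems.typeICertificateLadder_noBlowupToClay_proof. FluxDataBound, FluxVelocityBound,
SmallFluxRung, FoldLawEps, NoBlowupToClay are carried items (the quantitative form of crux 2, the
zoom's lemma, the first rung, the engine, the proved bridge), not hypotheses.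

Rationale: WHY THIS LINE. ENGINE (card planar-fold-law-unsigned-flux, re-derived by hand this session and
kit-checked by the card's author to 1.3e-14, j004755): for f = ω·n on a fixed plane, Kato's
inequality plus one in-plane integration by parts with ∇_∥·ω_∥ = −∂_n f makes TRANSPORT AND VORTEX
STRETCHING CANCEL IDENTICALLY; what is left is the 1-D heat operator in the height c, pair
annihilation on the nodal curves {f = 0} ∩ Π, one ε²-error, and a single signed inertial source —
normal velocity pushing a FOLD of vortex lines through the plane (the solar-MHD
polarity-inversion-line flux budget, Welsch doi:10.1086/498638, pointed at NS vorticity for the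
first time; support FoldLawEps states the ε-regularised identity exactly). Consequences: Φ* := sup_c
Φ ≤ Φ*(0) + (πν)^{-1/2}∫(t−τ)^{-1/2} S⁺(τ)dτ with the fold-creation rate S⁺ priced, after averaging
over n, by 4π∫|u||ω||∇ξ| (Constantin's direction gradient, doi:10.1007/bf02096982) — energy-class
input plus the (νt)^{-1/2} of the 1-D heat kernel lands EXACTLY at dimension 0, so crux 2 is the
L^{2,1}_t edge of known budgets, not a scaling miracle. REGULARITY SIDE (imported from card
circulation-density-liouville, (K)+(R)): slicing the Giga–Miyakawa ball density by the three
coordinate foliations gives sup_{x,r} r⁻¹∫_{B_r}|ω| ≤ 6Φ*, and the Biot–Savart split at the optimal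
radius gives ‖u‖²_∞ ≤ (2/π)‖ω‖_∞·6Φ* (support FluxVelocityBound); hence at bounded flux vorticity
records diverge at blow-up, the vorticity-normalised zoom (KNSS2009 Prop 6.1 with a different clock;
in-tree KNSS2009_blowup_generates_ancient_holds is the velocity-clock version) is velocity-bounded,
and its limit is a bounded ancient mild solution with |curl v| = 1 somewhere — non-constant for
free, for Type I and Type II alike — carrying the same flux bound (scale invariance + Fatou). So no
rate dichotomy and no import of the shared NoTypeII crux (stmt-0056): the route's Type-II content
sits inside crux 2. The Liouville crux lives in a NEW hypothesis class (vorticity uniformly L¹ on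
planes): it excludes by hypothesis the generic |y|⁻² tangential vorticity tails of (D)SS/Type-I
profiles (log-divergent flux on planes through the centre; ChaeWolf2017Removing) and contains
Lei–Zhang's axisymmetric BMO⁻¹ Liouville theorem as a proved corner (‖A‖_BMO ≲ G ≤ 6Φ*, LeiZhang2011
Thm 1.2), while the small-flux rung is Giga–Miyakawa's theorem (support SmallFluxRung,
GigaMiyakawa1989). Imported areas: kinematic MHD/dynamo flux bookkeeping (the PIL budget,
cancellation exponents: Ott et al. doi:10.1103/PhysRevLett.69.2654), GMT/coarea, parabolic
Liouville/blow-up rescaling (KNSS2009, SereginSverak2009), Morrey-space mild theory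
(GigaMiyakawa1989). What no prior route does: an EXACT evolution law for a CRITICAL quantity of 3-D
NS in which stretching is absent (ThreadingFlux: radial flux on spheres at the singular point,
Type-I dichotomy, no law; DirectionEnergy/DirectionDissipationQuantum: |∇ξ|² as an ε-regularity
pivot; TautLoopKelvin: signed circulation; GaldiLiouvilleGate: enstrophy-record clock,
finite-Dirichlet class); negatives index (3 entries: CorrectorSolvable, FiniteTangentModuli,
BlowupClayNonuniqueness) untouched — the Liouville crux concludes slice-wise constancy, so the
parasitic drifts b(t) of the duality-form class (the FiniteTangentModuli witness type) satisfy it.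

RANKED CRUXES. #0 Target (target) — X = PlanarFluxAPriori ∧ BoundedFluxNoBlowup: (i) every classical
Leray–Hopf solution from a rapidly decaying datum on [0,T) has bounded unsigned planar vorticity
flux over all planes and all t < T; (ii) every such solution with bounded planar flux on [0,T)
extends smoothly past T. (why it might fail: (i) is a critical a-priori bound at the L^{2,1} edge of
the energy-class budgets (a sheet swept back and forth through a plane raises flux cheaply); (ii)
contains 'no fixed-circulation core collapse' (a collapsing ring keeps Φ* ≈ 2Γ) and an unproved
Liouville theorem.) [Constantin1990, KNSS2009, GigaMiyakawa1989, arXiv:1108.1165,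
doi:10.1086/498638]
#2 PlanarFluxAPriori (crux) — FOLD BUDGET (card K1, per-solution form): for every ν > 0, T > 0 and
every classical solution (u,p) of unforced NS on ℝ³×[0,T) that is Leray–Hopf from a rapidly decaying
datum u(0), there is M with ∫_{R({x₂=c})} |curl u(t)·R e₂| dA ≤ M for all t ∈ [0,T), all linear
isometries R and all heights c. By the fold law it suffices that the fold-creation rate S⁺_n lies in
L^{2,1}(0,T) for a.e. n (attack: split u·n on each nodal curve into mean — pure transport in c,
invisible at the maximising plane — and oscillation, paid by the annihilation term 2ν∫_Z|∇f|²/|∇_∥f|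
on the SAME curves plus the direction budget ν∫∫|ω||∇ξ|² ≤ C). [difficulty: open-problem] (why it
might fail: critical a-priori estimate; known budgets give the direction-averaged creation rate only
in L^{8/9}_t, not L^{2,1}; a vortex sheet swept back and forth through one plane makes S⁺ large with
little direction-bending; Hou's axisymmetric scenario has meridional flux ~ log(1/(T−t)).)
[Constantin1990, doi:10.1007/bf02101659, arXiv:1108.1165, doi:10.1086/498638,
Hou2022PotentiallySingularNS, Tao2016AveragedNS]
#3 PlanarFluxLiouville (crux) — LIOUVILLE IN THE PLANAR-FLUX CLASS: a bounded ancient mild solution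
v of NS (ν = 1) on ℝ³×(−∞,0) (KNSS duality-form class IsBoundedAncientMildSolution 1 v, measurable
slices), jointly smooth on (−∞,0)×ℝ³, whose vorticity has uniformly bounded unsigned flux through
every plane at every time, is spatially constant on every slice (v t ≡ b(t); the parasitic drifts of
the class satisfy this). Weaker than KNSS (L) (stmt-10661) and than the card's (L_G) (bounded
Giga–Miyakawa density, G ≤ 6·sup-flux); free structure: tangent flows at infinity are constant, v −
b = BS(curl v), tangential |y|⁻² vorticity tails are excluded by the hypothesis (log-divergent
planar flux), Lei–Zhang's axisymmetric L^∞BMO⁻¹ Liouville theorem is the proved corner. [difficulty: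
open-problem] (why it might fail: no Liouville theorem is known under an L¹-on-planes vorticity
hypothesis; a bounded ancient flow with filamentary, radially threaded (purely radial |y|⁻² tail)
vorticity — e.g. a swirling-jet-like (R)DSS profile — has bounded planar flux and would refute it
together with (L).) [KNSS2009, SereginSverak2009, ChaeWolf2017Removing, LeiZhang2011,
AlbrittonBarker2019]
#4 FluxDataBound (crux) — QUANTITATIVE FOLD BUDGET (the falsifiable, scale-aware form of crux 2;
what a fold-law proof would actually deliver): for every ν > 0, T > 0 and A there is M = M(ν,T,A)
such that every classical Leray–Hopf solution on [0,T) from a rapidly decaying datum with ∫|u₀|² ≤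
A, ∫|curl u₀| ≤ A and initial planar flux ≤ A on every plane has planar flux ≤ M on every plane for
all t < T. The small-A rung is Giga–Miyakawa (support SmallFluxRung); K41 bookkeeping predicts the
growth law Φ*/ν ≲ (Φ*(0)/ν)^{3/2}. [deps: PlanarFluxAPriori] [difficulty: open-problem] (why it
might fail: uniform in very rough data norms: a bounded-energy family whose folds pump planar flux
without bound before a fixed time T (coherent sheet sweeping, reconnection avalanches at fixed E₀,
‖ω₀‖₁, Φ₀) kills it while the per-solution crux 2 survives.) [Constantin1990, GigaMiyakawa1989,
doi:10.1017/jfm.2019.905, MoffattKimura2019, doi:10.1017/jfm.2020.58, Hou2022PotentiallySingularNS]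
#9 FluxZoom (support) — VORTICITY-RECORD ZOOM AT BOUNDED FLUX (glue of BoundedFluxNoBlowup, used by
`closes`; card circulation-density-liouville (R) with planar flux in place of G): if a classical
Leray–Hopf solution from a rapidly decaying datum has no smooth extension past T while its planar
flux stays ≤ M on [0,T), then — since ‖u‖²_∞ ≤ C‖ω‖_∞·Φ* (FluxVelocityBound) makes bounded vorticity
imply bounded velocity, hence extension (in-tree hasSmoothExtensionPast_of_bounded_holds) —
vorticity records W_k ↑ ∞ exist; rescaling by λ_k = (ν/W_k)^{1/2} at near-record points (and
normalising ν = 1) gives velocity-bounded, vorticity-bounded solutions on growing pasts whose limit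
v is a bounded ancient mild solution (ν = 1), measurable and jointly smooth, with planar flux ≤ M/ν
on every plane and slice (scale invariance + Fatou) and |curl v| ≥ 1/2 at some point of some slice t
< 0, hence NOT constant there. [difficulty: L] [KNSS2009, SereginSverak2009, AlbrittonBarker2019,
MajdaBertozzi2002]
#9 FluxVelocityBound (support) — VELOCITY FROM VORTICITY MAXIMUM × PLANAR FLUX (provable now): there
is an absolute C such that every smooth, rapidly decaying, divergence-free u on ℝ³ with ‖curl u‖_∞ ≤
W and unsigned flux ≤ Φ through every plane satisfies ‖u‖²_∞ ≤ C·W·Φ (Biot–Savart |u(x)| ≤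
(4π)⁻¹∫|ω||x−y|⁻² split at r₀ = (G/2πW)^{1/2} gives ‖u‖²_∞ ≤ (2/π)WG; slicing balls by the three
coordinate foliations gives G = sup r⁻¹∫_{B_r}|ω| ≤ 6Φ; C = 12/π works). [difficulty: provable-now]
[MajdaBertozzi2002, GigaMiyakawa1989, Constantin1990]
#9 SmallFluxRung (support) — SMALL-FLUX RUNG (provable from the literature): there is an absolute ε₀
> 0 such that a classical Leray–Hopf solution from a rapidly decaying datum whose INITIAL planar
flux is ≤ ε₀ν on every plane extends smoothly past every T (initial Giga–Miyakawa Morrey norm ≤ 6ε₀ν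
⇒ Giga–Miyakawa's global smooth small-Morrey solution, which coincides with u by weak–strong
uniqueness). The first rung of the flux-Reynolds ladder behind cruxes 2–4. [difficulty: M]
[GigaMiyakawa1989, doi:10.1080/03605308908820621, KNSS2009]
#9 FoldLawEps (support) — THE ε-REGULARISED FOLD LAW on the coordinate plane {x₂ = c} (provable now;
a kinematic identity, no NS solution needed): for ν, ε > 0... (any real ν), any smooth rapidly
decaying divergence-free u, ω = curl u, f = ω₂, F_ε = (f²+ε²)^{1/2}, vorticity tendency w = νΔω −
curl(ω × u): ∫_Π F_ε'(f) w₂ = ν∫_Π ∂₂²(F_ε∘f) − ν∫_Π F_ε''(f)|∇f|² − ∫_Π u₂ F_ε''(f)(ω₀∂₀f + ω₁∂₁f)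
− ε²∫_Π ∂₂u₂/F_ε(f), with F_ε' = f/F_ε, F_ε'' = ε²/F_ε³ — transport and stretching have cancelled;
as ε → 0 the three last terms become nodal annihilation 2ν∫_Z|∇f|²/|∇_∥f|, the fold source −2∫_Z u₂
ω_∥·ν_Z, and 0. [difficulty: provable-now] [doi:10.1086/498638, doi:10.1023/a:1025679813955,
Constantin1990, MajdaBertozzi2002]
#9 NoBlowupToClay (support) — shared local-theory assembly (verbatim
stmt-NavierStokesRegularity-0055, PROVED in tree by
Theorems.typeICertificateLadder_noBlowupToClay_proof): NoBlowup → Clay (A). [difficulty: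
provable-now] [Fefferman2000, Leray1934, KNSS2009]

TWO-LAYER PLAN. Foreseen glued splits (not filed): PlanarFluxAPriori ⇐ HeatKernelFluxBound (Φ*(t) ≤
Φ*(0) + (πν)^{-1/2}∫₀ᵗ(t−τ)^{-1/2}S⁺_ε(τ)dτ, provable from FoldLawEps + decay) → FoldCreationBudget
(sup_t ∫₀ᵗ(t−τ)^{-1/2}S⁺(τ)dτ < ∞, the real crux) → PlanarFluxAPriori; PlanarFluxLiouville ⇐
TangentFlowAtInfinityConstant (blow-downs irrotational) → RadialTailLiouville (ancient flows whose
trace vorticity is purely radial / threaded) → PlanarFluxLiouville; FluxZoom ⇐ FluxVelocityBound →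
VorticityRecordCompactness → FluxZoom (k ≤ 3, depth 1 each).

KILL CRITERIA. A bounded ancient mild solution with bounded planar flux that is non-constant on a
slice refutes PlanarFluxLiouville (and KNSS (L), stmt-10661, with it): close
`refuted:PlanarFluxLiouville` unless the witness has unbounded flux-Reynolds structure the a-priori
side can still exclude (then pivot crux 3 to the zoom-limit subclass). A blow-up of a Clay solution
with bounded planar flux refutes BoundedFluxNoBlowup = ¬A outright. A smooth bounded-data family
with unbounded flux before a fixed T refutes FluxDataBound only — drop it (not in `closes`) and keep
the per-solution crux 2; a blow-up with Φ* → ∞ (e.g. Hou's log) refutes crux 2 = ¬A. NoBlowup proved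
elsewhere (TypeILiouville target, stmt-0054) moots the route; KNSS (L) proved elsewhere closes crux
3 at once.

NOT DECOMPOSED YET. The fold-creation budget itself (mean/oscillation split of u·n on nodal curves,
annihilation-vs-creation on the same curves, the coarea price ∫S⁺_n dn ≤ 4π∫|u||ω||∇ξ|) — children
of crux 2 once FoldLawEps and the heat-kernel bound land; the radial-tail (threaded) sub-case of
crux 3 and its relation to ThreadingFlux's ThreadedNoBlowup (stmt-1219); the compactness bookkeeping
of FluxZoom (vorticity clock instead of the in-tree velocity clock); the corners (2-D, axisymmetric
no-swirl: S ≡ 0, Φ* non-increasing) as calibration lemmas; the definition request unsignedPlanarFlux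
(inlined in every item for now).

CHEAPEST FALSIFIER. Run the fold law and the flux diagnostic on the canonical near-singular
computations — Hou's axisymmetric interior scenario (arXiv:2107.06509; meridional flux =
‖ω_θ‖_{L¹(dr dz)}, predicted ~ log(1/(T−t)) from his fits), Moffatt–Kimura's tent/pyramid
reconnection at fixed Γ (doi:10.1017/jfm.2018.882, regularised per Yao–Hussain
doi:10.1017/jfm.2020.58), Kerr-type antiparallel tubes: track Φ*_n(t) against ‖ω‖_∞; Φ* saturating
while ‖ω‖_∞ grows without bound would CONTRADICT BoundedFluxNoBlowup in that scenario (refuting the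
route if the scenario is a true blow-up), Φ* growing like a power of ‖ω‖_∞ at bounded data norms
kills FluxDataBound. Lookup already run: no Liouville theorem or a-priori bound for planar L¹
vorticity in print (searches in § Novelty); the card's own toy runs (kit j004756, j004759: Φ*
×1.5–2.0 while ‖ω‖_∞ ×6.6 at Re ≈ 700–1400) are consistent with crux 4.

NUMBERS. Constantin1990: sup_t ‖ω(t)‖_{L¹} ≤ ‖ω₀‖_{L¹} + C‖u₀‖²_{L²}/ν and ν∫∫|ω||∇ξ|² bounded
(energy dimension −1); Φ* has dimension 0. FluxVelocityBound: ‖u‖²_∞ ≤ (2/π)‖ω‖_∞·G, G ≤ 6Φ* (C =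
12/π ≈ 3.82). Giga–Miyakawa small-Morrey threshold ε₀ν (1989). Type-I/DSS profiles: |Ω(y)| ≲
(1+|y|)⁻² (ChaeWolf2017Removing Thm 1.1) ⇒ planar flux through the centre ~ C log(1/(T−t)) unless
the tail is purely radial. Card numerics: Φ* ×1.5–2.0 vs ‖ω‖_∞ ×6.6, creation/annihilation 1.4–1.8
at the maximising plane (kit j004756). Items at open: 10 (target, assembly, 3 cruxes, 5 supports).

DEFINITION REQUESTS. None blocking: every item is stated inline over
Literature.Analysis.FluidPDE.{curl, IsClassicalNSSolutionOn, IsLerayHopfOn, HasRapidSpatialDecay,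
HasSmoothExtensionPast, IsBoundedAncientMildSolution, VectorCalculus.IsDivFree, cross} + Mathlib
(lintegral over EuclideanSpace ℝ (Fin 2), LinearIsometryEquiv, Laplacian.laplacian). Wanted later
(convenience, `--kind definition --topic
Summits/NavierStokesRegularity/NavierStokesRegularity/Theorems`): unsignedPlanarFlux u R c := ∫⁻ y,
‖⟪curl u (R (y₀,y₁,c)), R e₂⟫‖ₑ and foldCreationEps u R c ε.

Novelty: Searches (2026-08-16): `lit search --hybrid "unsigned vorticity flux through a plane Navier-Stokes a
priori estimate"` (8 held-book page hits: Majda–Bertozzi, Doering–Gibbon, Davidson MHD, … — none on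
an evolution law or bound); `lit galaxy search "unsigned vorticity flux" --star all` (0), `"flux of
vorticity through a plane" --star all` (0), `"cancellation exponent" --star all` (8: dynamo books +
Vainshtein–Sreenivasan PRE 1994), `"vortex stretching cancels" --star all` (0); `lit search --source
crossref` Moffatt–Kimura (doi:10.1017/jfm.2018.882, 2019.263, 2023.472) and Yao–Hussain
(doi:10.1017/jfm.2020.58); `lit search --source zbmath` Giga–Miyakawa
(doi:10.1080/03605308908820621); all 64 thesis files of the sub read (heads) and the 24 open / 133
closed card titles; the spine card's own searches (2026-08-15/16: Constantin 1990 read pp.1–4, Tao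
arXiv:1108.1165 Prop 52, Klapper–Young, galaxy 'unsigned flux' 41 solar/dynamo rows, critic's
galaxy-intelligent PIL search → Welsch doi:10.1086/498638, Démoulin–Berger
doi:10.1023/a:1025679813955).
Nearest prior art found: Welsch doi:10.1086/498638 / Démoulin–Berger doi:10.1023/a:1025679813955
(the inertial part of the fold law for a frozen-in MAGNETIC field at polarity-inversion lines —
kinematics only, prescribed u); Constantin1990 doi:10.1007/bf02096982 (‖ω‖_{L¹} and direction
budget, no slicing, keeps ∫|ω||S|); GigaMiyakawa1989 (small Morrey data); KNSS2009 arXiv:0709.3599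
§6 (velocity-clock zoom, (L)); in-hub: card circulation-d  [refs: 10.1017/jfm.2018.882, 10.1017/jfm.2020.58, 10.1080/03605308908820621, 10.1086/498638, 10.1023/a:1025679813955, 10.1007/bf02096982, 1108.1165, 0709.3599, doi:10.1017/jfm.2018.882, doi:10.1017/jfm.2020.58, doi:10.1080/03605308908820621, doi:10.1086/498638, doi:10.1023/a, doi:10.1007/bf02096982, Constantin1990, GigaMiyakawa1989, KNSS2009]

Barriers (technique_class: sliced-kelvin-unsigned-flux, liouville-rigidity): - technique_class: sliced-kelvin-unsigned-flux, liouville-rigidity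
- Literature.Barriers.NavierStokesRegularity.TaoAveragedBlowup: evaded by construction — the fold
law is an L¹-endpoint physical-space identity using pointwise vorticity transport, div ω = 0 and
Kelvin's cancellation; it is FALSE for Tao's averaged bilinear forms (no frozen-in flux), so an
argument through crux 2 cannot prove the false averaged statement; the bet is that this structural
exit can be made quantitative (L^{2,1} fold budget).
- Literature.Barriers.NavierStokesRegularity.EnergySupercriticality: it applies to the GOAL (crux 2
is a critical a-priori bound) and is not claimed free; the dimension count is explicit —
energy-class input (Constantin's budgets, dimension −1) plus the (νt)^{-1/2} of the 1-D heat kernel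
in the height reaches dimension 0 exactly at the L^{2,1}_t edge; the Liouville crux and the zoom use
no energy bound at all.
- Literature.Barriers.NavierStokesRegularity.NavierStokesInequalitySingularSolution: evaded — the
law uses the vorticity EQUATION (curl of the momentum equation), which Scheffer/Ożański
local-energy-inequality solutions do not satisfy (the curl of the hidden force enters the plane
budget).
- Literature.Barriers.NavierStokesRegularity.CriticalNormBlowupNecessity: consistent — bounded
planar flux does not bound L³ (filamentary fields), so the class of crux 3 is not reachable by
ESS/GKP profile decompositions; the route neither uses nor contradicts L³ blow-up.
- Literature

History (route lifecycle, newest last):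
- 2026-08-25T05:41:44Z · DORMANT — reconciler: no traction for 7.4 d (last activity item-proof-filed at 2026-08-17T19:02:39Z); parked, not closed — `ledger route dormant route-NavierStokesRegular (operator:999:2915741)
- 2026-08-26T16:59:49Z · REACTIVATED — reconciler: reactivated — activity item-proof-filed at 2026-08-26T15:57:58Z after parking at 2026-08-25T05:41:44Z (operator:999:3436399)
- 2026-09-01T14:01:30Z · DORMANT — reconciler: no traction for 5 d (last activity statement-closed at 2026-08-27T12:56:20Z); parked, not closed — `ledger route dormant route-NavierStokesRegularit (operator:999:1894965)

sub-problem: NavierStokesRegularity · status: dormant · opened planner-plan-novel-NavierStokesRegularity-Navie-a989c6c0-v2-0 2026-08-16T15:46:03Z · rev 7 · ledger route-NavierStokesRegularity-SlicedKelvin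
GENERATED by the gate from the ledger (D-0016/17). Provers cite these decls: `theorem foo : Summit.NavierStokesRegularity.NavierStokesRegularity.Theses.SlicedKelvin.<Decl> := …` in Summits/NavierStokesRegularity/NavierStokesRegularity/Theorems/<Name>.lean.
-/

namespace Summit.NavierStokesRegularity.NavierStokesRegularity.Theses.SlicedKelvin

open scoped BigOperators Topology Manifold Classical MeasureTheory ProbabilityTheory Matrix InnerProductSpace ComplexConjugate ContinuousMap
open Filter Set Function TopologicalSpace MeasureTheory

attribute [summit_statement] _root_.NavierStokesRegularity

open Literature.NS

/-- item stmt-NavierStokesRegularity-15599 · target · rank 0 · open · by planner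
why it might fail: (i) is a critical a-priori bound at the L^{2,1} edge of the energy-class budgets (a sheet swept back and forth through a plane raises flux cheaply); (ii) contains 'no fixed-circulation core collapse' (a collapsing ring keeps Φ* ≈ 2Γ) and an unproved Liouville theorem.
sources: Constantin1990, KNSS2009, GigaMiyakawa1989, arXiv:1108.1165, doi:10.1086/498638
[target] X = PlanarFluxAPriori ∧ BoundedFluxNoBlowup: (i) every classical Leray–Hopf solution from a
rapidly decaying datum on [0,T) has bounded unsigned planar vorticity flux over all planes and all t
< T; (ii) every such solution with bounded planar flux on [0,T) extends smoothly past T. -/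
@[route_item "route-NavierStokesRegularity-SlicedKelvin"]
def Target : Prop :=
  (∀ (ν T : ℝ), 0 < ν → 0 < T → ∀ (u : ℝ → EuclideanSpace ℝ (Fin 3) → EuclideanSpace ℝ (Fin 3)) (p : ℝ → EuclideanSpace ℝ (Fin 3) → ℝ), Literature.Analysis.FluidPDE.IsClassicalNSSolutionOn (Set.Ico 0 T) ν 0 u p → Literature.Analysis.FluidPDE.IsLerayHopfOn T ν 0 (u 0) u → Literature.Analysis.FluidPDE.HasRapidSpatialDecay (u 0) → ∃ M : ℝ, ∀ t ∈ Set.Ico 0 T, ∀ (R : EuclideanSpace ℝ (Fin 3) ≃ₗᵢ[ℝ] EuclideanSpace ℝ (Fin 3)) (c : ℝ), ∫⁻ y : EuclideanSpace ℝ (Fin 2), ‖inner ℝ (Literature.Analysis.FluidPDE.curl (u t) (R (WithLp.toLp 2 ![y 0, y 1, c]))) (R (EuclideanSpace.single 2 1))‖ₑ ≤ ENNReal.ofReal M) ∧ (∀ (ν T : ℝ), 0 < ν → 0 < T → ∀ (u : ℝ → EuclideanSpace ℝ (Fin 3) → EuclideanSpace ℝ (Fin 3)) (p : ℝ → EuclideanSpace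 ℝ (Fin 3) → ℝ), Literature.Analysis.FluidPDE.IsClassicalNSSolutionOn (Set.Ico 0 T) ν 0 u p → Literature.Analysis.FluidPDE.IsLerayHopfOn T ν 0 (u 0) u → Literature.Analysis.FluidPDE.HasRapidSpatialDecay (u 0) → (∃ M : ℝ, ∀ t ∈ Set.Ico 0 T, ∀ (R : EuclideanSpace ℝ (Fin 3) ≃ₗᵢ[ℝ] EuclideanSpace ℝ (Fin 3)) (c : ℝ), ∫⁻ y : EuclideanSpace ℝ (Fin 2), ‖inner ℝ (Literature.Analysis.FluidPDE.curl (u t) (R (WithLp.toLp 2 ![y 0, y 1, c]))) (R (EuclideanSpace.single 2 1))‖ₑ ≤ ENNReal.ofReal M) → Literature.Analysis.FluidPDE.HasSmoothExtensionPast ν 0 u T)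

/-- item stmt-NavierStokesRegularity-15600 · crux · rank 2 · open · by planner
why it might fail: critical a-priori estimate; known budgets give the direction-averaged creation rate only in L^{8/9}_t, not L^{2,1}; a vortex sheet swept back and forth through one plane makes S⁺ large with little direction-bending; Hou's axisymmetric scenario has meridional flux ~ log(1/(T−t)).
sources: Constantin1990, doi:10.1007/bf02101659, arXiv:1108.1165, doi:10.1086/498638, Hou2022PotentiallySingularNS, Tao2016AveragedNS
[crux] FOLD BUDGET (card K1, per-solution form): for every ν > 0, T > 0 and every classical solution
(u,p) of unforced NS on ℝ³×[0,T) that is Leray–Hopf from a rapidly decaying datum u(0), there is M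
with ∫_{R({x₂=c})} |curl u(t)·R e₂| dA ≤ M for all t ∈ [0,T), all linear isometries R and all
heights c. By the fold law it suffices that the fold-creation rate S⁺_n lies in L^{2,1}(0,T) for
a.e. n (attack: split u·n on each nodal curve into mean — pure transport in c, invisible at the
maximising plane — and oscillation, paid by the annihilation term 2ν∫_Z|∇f|²/|∇_∥f| on the SAME
curves plus the direction budget ν∫∫|ω||∇ξ|² ≤ C). [difficulty: open-problem] -/
@[route_item "route-NavierStokesRegularity-SlicedKelvin", crux]
def PlanarFluxAPriori : Prop :=
  ∀ (ν T : ℝ), 0 < ν → 0 < T → ∀ (u : ℝ → EuclideanSpace ℝ (Fin 3) → EuclideanSpace ℝ (Fin 3)) (p : ℝ → EuclideanSpace ℝ (Fin 3) → ℝ), Literature.Analysis.FluidPDE.IsClassicalNSSolutionOn (Set.Ico 0 T) ν 0 u p → Literature.Analysis.FluidPDE.IsLerayHopfOn T ν 0 (u 0) u → Literature.Analysis.FluidPDE.HasRapidSpatialDecay (u 0) → ∃ M : ℝ, ∀ t ∈ Set.Ico 0 T, ∀ (R : EuclideanSpace ℝ (Fin 3) ≃ₗᵢ[ℝ] EuclideanSpace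 ℝ (Fin 3)) (c : ℝ), ∫⁻ y : EuclideanSpace ℝ (Fin 2), ‖inner ℝ (Literature.Analysis.FluidPDE.curl (u t) (R (WithLp.toLp 2 ![y 0, y 1, c]))) (R (EuclideanSpace.single 2 1))‖ₑ ≤ ENNReal.ofReal M

/-- item stmt-NavierStokesRegularity-18181 · crux · rank 2 · open · by planner
why it might fail: NS-critical and stronger than the crux by the apex foam (apex pairs in the slab whose bars miss c count in τ(S_h), not in Φ); log-divergent on tailed backward-DSS / Hou blow-up like the crux; the t₀ = 0 version is false for admissible data (Disproof §C2).
sources: Constantin1990, doi:10.1007/bf02096982, MajdaBertozzi2002, doi:10.2307/1969467, ChaeWolf2017Removing, Hou2022PotentiallySingularNS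
[crux] SLAB APEX BOUND — the transfer target C⁺ of card halfspace-apex-identity in positive-time
form (= the one remaining registered stub stub_slabApexBound of the live line Sketch; the reduction
SlabApexBound → PlanarFluxAPriori is LANDED, p161462): along every classical Leray–Hopf solution on
[0,T) from a rapidly decaying datum and for every t₀ ∈ (0,T) there are M and a slab half-width h > 0
such that the regularised Γ-weighted APEX MEASURE liminf_{ε→0⁺} ∫_{|⟪x,Re₂⟫−c|<h}
(ε²/√(f²+ε²)³)·|Df[curl u(t)]| dx, f = ⟪curl u(t), Re₂⟫ (= 2∫_{Z∩slab}|ω·N| dH² on generic slices: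
the circulation-weighted number of turning points of the height along vortex lines in the slab) is ≤
M for all t ∈ [t₀,T), frames R, heights c. By the half-space apex identity planar flux =
2·(Γ-weighted maxima − minima of the height above the plane); folds of amplitude ≥ h are paid by
Constantin's L¹ bound (ApexSlabSplit + VorticityMassBound), so the whole open content of the parent
crux is 'no apex crowding in a slab'. Attack (line Sketch / skeleton local-far): Ertel births-only
law (transport and sliding cancel identically in dτ_ε/dt; births only on the codimension-2
inflection locus {f = 0, (ω·∇)f = 0} with de -/
@[route_item "route-NavierStokesRegularity-SlicedKelvin"]
def SlabApexBound : Prop :=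
  ∀ (ν T : ℝ), 0 < ν → 0 < T → ∀ (u : ℝ → EuclideanSpace ℝ (Fin 3) → EuclideanSpace ℝ (Fin 3)) (p : ℝ → EuclideanSpace ℝ (Fin 3) → ℝ), Literature.Analysis.FluidPDE.IsClassicalNSSolutionOn (Set.Ico 0 T) ν 0 u p → Literature.Analysis.FluidPDE.IsLerayHopfOn T ν 0 (u 0) u → Literature.Analysis.FluidPDE.HasRapidSpatialDecay (u 0) → ∀ t₀ ∈ Set.Ioo 0 T, ∃ M : NNReal, ∃ h : ℝ, 0 < h ∧ ∀ t ∈ Set.Ico t₀ T, ∀ (R : EuclideanSpace ℝ (Fin 3) ≃ₗᵢ[ℝ] EuclideanSpace ℝ (Fin 3)) (c : ℝ), Filter.liminf (fun ε : ℝ => ∫⁻ x in {x : EuclideanSpace ℝ (Fin 3) | |inner ℝ x (R (EuclideanSpace.single 2 1)) - c| < h}, ENNReal.ofReal (ε ^ 2 / Real.sqrt (inner ℝ (Literature.Analysis.FluidPDE.curl (u t) x) (R (EuclideanSpace.single 2 1)) ^ 2 + ε ^ 2) ^ 3 * |fderiv ℝ (fun z => inner ℝ (Literature.Analysis.FluidPDE.curl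 (u t) z) (R (EuclideanSpace.single 2 1))) x (Literature.Analysis.FluidPDE.curl (u t) x)|)) (nhdsWithin 0 (Set.Ioi 0)) ≤ (M : ENNReal)

/-- item stmt-NavierStokesRegularity-15601 · crux · rank 3 · open · by planner
why it might fail: no Liouville theorem is known under an L¹-on-planes vorticity hypothesis; a bounded ancient flow with filamentary, radially threaded (purely radial |y|⁻² tail) vorticity — e.g. a swirling-jet-like (R)DSS profile — has bounded planar flux and would refute it together with (L).
sources: KNSS2009, SereginSverak2009, ChaeWolf2017Removing, LeiZhang2011, AlbrittonBarker2019
[crux] LIOUVILLE IN THE PLANAR-FLUX CLASS: a bounded ancient mild solution v of NS (ν = 1) on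
ℝ³×(−∞,0) (KNSS duality-form class IsBoundedAncientMildSolution 1 v, measurable slices), jointly
smooth on (−∞,0)×ℝ³, whose vorticity has uniformly bounded unsigned flux through every plane at
every time, is spatially constant on every slice (v t ≡ b(t); the parasitic drifts of the class
satisfy this). Weaker than KNSS (L) (stmt-10661) and than the card's (L_G) (bounded Giga–Miyakawa
density, G ≤ 6·sup-flux); free structure: tangent flows at infinity are constant, v − b = BS(curl
v), tangential |y|⁻² vorticity tails are excluded by the hypothesis (log-divergent planar flux),
Lei–Zhang's axisymmetric L^∞BMO⁻¹ Liouville theorem is the proved corner. [difficulty: open-problem] -/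
@[route_item "route-NavierStokesRegularity-SlicedKelvin", crux]
def PlanarFluxLiouville : Prop :=
  ∀ (v : ℝ → EuclideanSpace ℝ (Fin 3) → EuclideanSpace ℝ (Fin 3)), Literature.Analysis.FluidPDE.IsBoundedAncientMildSolution 1 v → (∀ t < 0, MeasureTheory.AEStronglyMeasurable (v t) MeasureTheory.volume) → ContDiffOn ℝ (⊤ : ℕ∞) (Function.uncurry v) (Set.Iio 0 ×ˢ Set.univ) → (∃ M : ℝ, ∀ t < 0, ∀ (R : EuclideanSpace ℝ (Fin 3) ≃ₗᵢ[ℝ] EuclideanSpace ℝ (Fin 3)) (c : ℝ), ∫⁻ y : EuclideanSpace ℝ (Fin 2), ‖inner ℝ (Literature.Analysis.FluidPDE.curl (v t) (R (WithLp.toLp 2 ![y 0, y 1, c]))) (R (EuclideanSpace.single 2 1))‖ₑ ≤ ENNReal.ofReal M) → ∀ t < 0, ∃ b : EuclideanSpace ℝ (Fin 3), ∀ x, v t x = b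

/-- item stmt-NavierStokesRegularity-15603 · crux · rank 9 · closed · proved by Summit.NavierStokesRegularity.NavierStokesRegularity.Theorems.slicedKelvin_fluxZoom_proof @ 791e04fe00c3 (prover) · by planner
why it might fail: vorticity-clock zoom in the duality-form mild class: the limit must keep the mild identity, joint smoothness and the flux bound (Fatou on every plane) while near-record points may drift; only the velocity-clock version (KNSS Prop 6.1) is proved in tree.
sources: KNSS2009, SereginSverak2009, AlbrittonBarker2019, MajdaBertozzi2002, GigaMiyakawa1989
[support] VORTICITY-RECORD ZOOM AT BOUNDED FLUX (glue of BoundedFluxNoBlowup, used by `closes`; card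
circulation-density-liouville (R) with planar flux in place of G): if a classical Leray–Hopf
solution from a rapidly decaying datum has no smooth extension past T while its planar flux stays ≤
M on [0,T), then — since ‖u‖²_∞ ≤ C‖ω‖_∞·Φ* (FluxVelocityBound) makes bounded vorticity imply
bounded velocity, hence extension (in-tree hasSmoothExtensionPast_of_bounded_holds) — vorticity
records W_k ↑ ∞ exist; rescaling by λ_k = (ν/W_k)^{1/2} at near-record points (and normalising ν =
1) gives velocity-bounded, vorticity-bounded solutions on growing pasts whose limit v is a bounded
ancient mild solution (ν = 1), measurable and jointly smooth, with planar flux ≤ M/ν on every plane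
and slice (scale invariance + Fatou) and |curl v| ≥ 1/2 at some point of some slice t < 0, hence NOT
constant there. [difficulty: L] -/
@[route_item "route-NavierStokesRegularity-SlicedKelvin", crux]
def FluxZoom : Prop :=
  ∀ (ν T : ℝ), 0 < ν → 0 < T → ∀ (u : ℝ → EuclideanSpace ℝ (Fin 3) → EuclideanSpace ℝ (Fin 3)) (p : ℝ → EuclideanSpace ℝ (Fin 3) → ℝ), Literature.Analysis.FluidPDE.IsClassicalNSSolutionOn (Set.Ico 0 T) ν 0 u p → Literature.Analysis.FluidPDE.IsLerayHopfOn T ν 0 (u 0) u → Literature.Analysis.FluidPDE.HasRapidSpatialDecay (u 0) → ¬ Literature.Analysis.FluidPDE.HasSmoothExtensionPast ν 0 u T → (∃ M : ℝ, ∀ t ∈ Set.Ico 0 T, ∀ (R : EuclideanSpace ℝ (Fin 3) ≃ₗᵢ[ℝ] EuclideanSpace ℝ (Fin 3)) (c : ℝ), ∫⁻ y : EuclideanSpace ℝ (Fin 2), ‖inner ℝ (Literature.Analysis.FluidPDE.curl (u t) (R (WithLp.toLp 2 ![y 0, y 1, c]))) (R (EuclideanSpace.single 2 1))‖ₑ ≤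 ENNReal.ofReal M) → ∃ (v : ℝ → EuclideanSpace ℝ (Fin 3) → EuclideanSpace ℝ (Fin 3)) (M' : ℝ), Literature.Analysis.FluidPDE.IsBoundedAncientMildSolution 1 v ∧ (∀ t < 0, MeasureTheory.AEStronglyMeasurable (v t) MeasureTheory.volume) ∧ ContDiffOn ℝ (⊤ : ℕ∞) (Function.uncurry v) (Set.Iio 0 ×ˢ Set.univ) ∧ (∀ t < 0, ∀ (R : EuclideanSpace ℝ (Fin 3) ≃ₗᵢ[ℝ] EuclideanSpace ℝ (Fin 3)) (c : ℝ), ∫⁻ y : EuclideanSpace ℝ (Fin 2), ‖inner ℝ (Literature.Analysis.FluidPDE.curl (v t) (R (WithLp.toLp 2 ![y 0, y 1, c]))) (R (EuclideanSpace.single 2 1))‖ₑ ≤ ENNReal.ofReal M') ∧ ∃ t < 0, ¬ ∃ b : EuclideanSpace ℝ (Fin 3), ∀ x, v t x = b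

-- `FluxZoom` holds: proved by `Summit.NavierStokesRegularity.NavierStokesRegularity.Theorems.slicedKelvin_fluxZoom_proof` @ 791e04fe00c3 (its module imports this route file, so no `_holds` link can be stated here).

/-- item stmt-NavierStokesRegularity-15602 · support · rank 4 · open · by planner
why it might fail: uniform in very rough data norms: a bounded-energy family whose folds pump planar flux without bound before a fixed time T (coherent sheet sweeping, reconnection avalanches at fixed E₀, ‖ω₀‖₁, Φ₀) kills it while the per-solution crux 2 survives.
sources: Constantin1990, GigaMiyakawa1989, doi:10.1017/jfm.2019.905, MoffattKimura2019, doi:10.1017/jfm.2020.58, Hou2022PotentiallySingularNS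
[crux] QUANTITATIVE FOLD BUDGET (the falsifiable, scale-aware form of crux 2; what a fold-law proof
would actually deliver): for every ν > 0, T > 0 and A there is M = M(ν,T,A) such that every
classical Leray–Hopf solution on [0,T) from a rapidly decaying datum with ∫|u₀|² ≤ A, ∫|curl u₀| ≤ A
and initial planar flux ≤ A on every plane has planar flux ≤ M on every plane for all t < T. The
small-A rung is Giga–Miyakawa (support SmallFluxRung); K41 bookkeeping predicts the growth law Φ*/ν
≲ (Φ*(0)/ν)^{3/2}. [deps: PlanarFluxAPriori] [difficulty: open-problem] -/
@[route_item "route-NavierStokesRegularity-SlicedKelvin"]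
def FluxDataBound : Prop :=
  ∀ (ν T A : ℝ), 0 < ν → 0 < T → ∃ M : ℝ, ∀ (u : ℝ → EuclideanSpace ℝ (Fin 3) → EuclideanSpace ℝ (Fin 3)) (p : ℝ → EuclideanSpace ℝ (Fin 3) → ℝ), Literature.Analysis.FluidPDE.IsClassicalNSSolutionOn (Set.Ico 0 T) ν 0 u p → Literature.Analysis.FluidPDE.IsLerayHopfOn T ν 0 (u 0) u → Literature.Analysis.FluidPDE.HasRapidSpatialDecay (u 0) → (∫⁻ x, ‖u 0 x‖ₑ ^ 2 ≤ ENNReal.ofReal A) → (∫⁻ x, ‖Literature.Analysis.FluidPDE.curl (u 0) x‖ₑ ≤ ENNReal.ofReal A) → (∀ (R : EuclideanSpace ℝ (Fin 3) ≃ₗᵢ[ℝ] EuclideanSpace ℝ (Fin 3)) (c : ℝ), ∫⁻ y : EuclideanSpace ℝ (Fin 2), ‖inner ℝ (Literature.Analysis.FluidPDE.curl (u 0) (R (WithLp.toLp 2 ![y 0, y 1, c]))) (R (EuclideanSpace.single 2 1))‖ₑ ≤ ENNReal.ofReal A) → ∀ t ∈ Set.Ico 0 T, ∀ (R : EuclideanSpace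 ℝ (Fin 3) ≃ₗᵢ[ℝ] EuclideanSpace ℝ (Fin 3)) (c : ℝ), ∫⁻ y : EuclideanSpace ℝ (Fin 2), ‖inner ℝ (Literature.Analysis.FluidPDE.curl (u t) (R (WithLp.toLp 2 ![y 0, y 1, c]))) (R (EuclideanSpace.single 2 1))‖ₑ ≤ ENNReal.ofReal M

/-- item stmt-NavierStokesRegularity-15604 · support · rank 9 · closed · proved by Summit.NavierStokesRegularity.NavierStokesRegularity.Theorems.slicedKelvin_fluxVelocityBound_proof (prover) · by planner
sources: MajdaBertozzi2002, GigaMiyakawa1989, Constantin1990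
[support] VELOCITY FROM VORTICITY MAXIMUM × PLANAR FLUX (provable now): there is an absolute C such
that every smooth, rapidly decaying, divergence-free u on ℝ³ with ‖curl u‖_∞ ≤ W and unsigned flux ≤
Φ through every plane satisfies ‖u‖²_∞ ≤ C·W·Φ (Biot–Savart |u(x)| ≤ (4π)⁻¹∫|ω||x−y|⁻² split at r₀ =
(G/2πW)^{1/2} gives ‖u‖²_∞ ≤ (2/π)WG; slicing balls by the three coordinate foliations gives G = sup
r⁻¹∫_{B_r}|ω| ≤ 6Φ; C = 12/π works). [difficulty: provable-now] -/
@[route_item "route-NavierStokesRegularity-SlicedKelvin"]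
def FluxVelocityBound : Prop :=
  ∃ C : ℝ, ∀ (u : EuclideanSpace ℝ (Fin 3) → EuclideanSpace ℝ (Fin 3)), ContDiff ℝ (⊤ : ℕ∞) u → Literature.Analysis.FluidPDE.HasRapidSpatialDecay u → Literature.Analysis.FluidPDE.VectorCalculus.IsDivFree u → ∀ (W Φ : ℝ), 0 ≤ W → 0 ≤ Φ → (∀ x, ‖Literature.Analysis.FluidPDE.curl u x‖ ≤ W) → (∀ (R : EuclideanSpace ℝ (Fin 3) ≃ₗᵢ[ℝ] EuclideanSpace ℝ (Fin 3)) (c : ℝ), ∫⁻ y : EuclideanSpace ℝ (Fin 2), ‖inner ℝ (Literature.Analysis.FluidPDE.curl u (R (WithLp.toLp 2 ![y 0, y 1, c]))) (R (EuclideanSpace.single 2 1))‖ₑ ≤ ENNReal.ofReal Φ) → ∀ x, ‖u x‖ ^ 2 ≤ C * W * Φ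

-- `FluxVelocityBound` holds: proved by `Summit.NavierStokesRegularity.NavierStokesRegularity.Theorems.slicedKelvin_fluxVelocityBound_proof` (its module imports this route file, so no `_holds` link can be stated here).

/-- item stmt-NavierStokesRegularity-15605 · support · rank 9 · open · by planner
sources: GigaMiyakawa1989, doi:10.1080/03605308908820621, KNSS2009
[support] SMALL-FLUX RUNG (provable from the literature): there is an absolute ε₀ > 0 such that a
classical Leray–Hopf solution from a rapidly decaying datum whose INITIAL planar flux is ≤ ε₀ν on
every plane extends smoothly past every T (initial Giga–Miyakawa Morrey norm ≤ 6ε₀ν ⇒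
Giga–Miyakawa's global smooth small-Morrey solution, which coincides with u by weak–strong
uniqueness). The first rung of the flux-Reynolds ladder behind cruxes 2–4. [difficulty: M] -/
@[route_item "route-NavierStokesRegularity-SlicedKelvin"]
def SmallFluxRung : Prop :=
  ∃ ε₀ : ℝ, 0 < ε₀ ∧ ∀ (ν T : ℝ), 0 < ν → 0 < T → ∀ (u : ℝ → EuclideanSpace ℝ (Fin 3) → EuclideanSpace ℝ (Fin 3)) (p : ℝ → EuclideanSpace ℝ (Fin 3) → ℝ), Literature.Analysis.FluidPDE.IsClassicalNSSolutionOn (Set.Ico 0 T) ν 0 u p → Literature.Analysis.FluidPDE.IsLerayHopfOn T ν 0 (u 0) u → Literature.Analysis.FluidPDE.HasRapidSpatialDecay (u 0) → (∀ (R : EuclideanSpace ℝ (Fin 3) ≃ₗᵢ[ℝ] EuclideanSpace ℝ (Fin 3)) (c : ℝ), ∫⁻ y : EuclideanSpace ℝ (Fin 2), ‖inner ℝ (Literature.Analysis.FluidPDE.curl (u 0) (R (WithLp.toLp 2 ![y 0, y 1, c]))) (R (EuclideanSpace.single 2 1))‖ₑ ≤ ENNReal.ofReal (ε₀ * ν))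 → Literature.Analysis.FluidPDE.HasSmoothExtensionPast ν 0 u T

/-- item stmt-NavierStokesRegularity-15606 · support · rank 9 · closed · proved by Summit.NavierStokesRegularity.NavierStokesRegularity.Theorems.slicedKelvin_foldLawEps_proof (prover) · by planner
sources: doi:10.1086/498638, doi:10.1023/a:1025679813955, Constantin1990, MajdaBertozzi2002
[support] THE ε-REGULARISED FOLD LAW on the coordinate plane {x₂ = c} (provable now; a kinematic
identity, no NS solution needed): for ν, ε > 0... (any real ν), any smooth rapidly decaying
divergence-free u, ω = curl u, f = ω₂, F_ε = (f²+ε²)^{1/2}, vorticity tendency w = νΔω − curl(ω ×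
u): ∫_Π F_ε'(f) w₂ = ν∫_Π ∂₂²(F_ε∘f) − ν∫_Π F_ε''(f)|∇f|² − ∫_Π u₂ F_ε''(f)(ω₀∂₀f + ω₁∂₁f) − ε²∫_Π
∂₂u₂/F_ε(f), with F_ε' = f/F_ε, F_ε'' = ε²/F_ε³ — transport and stretching have cancelled; as ε → 0
the three last terms become nodal annihilation 2ν∫_Z|∇f|²/|∇_∥f|, the fold source −2∫_Z u₂ ω_∥·ν_Z,
and 0. [difficulty: provable-now] -/
@[route_item "route-NavierStokesRegularity-SlicedKelvin"]
def FoldLawEps : Prop :=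
  ∀ (ν ε c : ℝ), 0 < ε → ∀ (u : EuclideanSpace ℝ (Fin 3) → EuclideanSpace ℝ (Fin 3)), ContDiff ℝ (⊤ : ℕ∞) u → Literature.Analysis.FluidPDE.HasRapidSpatialDecay u → Literature.Analysis.FluidPDE.VectorCalculus.IsDivFree u → let ω : EuclideanSpace ℝ (Fin 3) → EuclideanSpace ℝ (Fin 3) := Literature.Analysis.FluidPDE.curl u; let f : EuclideanSpace ℝ (Fin 3) → ℝ := fun x => ω x 2; let w : EuclideanSpace ℝ (Fin 3) → EuclideanSpace ℝ (Fin 3) := fun x => ν • Laplacian.laplacian ω x - Literature.Analysis.FluidPDE.curl (fun z => Literature.Analysis.FluidPDE.cross (ω z) (u z)) x; let F : ℝ → ℝ := fun s => Real.sqrt (s ^ 2 + ε ^ 2); let D : (EuclideanSpace ℝ (Fin 3) → ℝ) → Fin 3 → EuclideanSpace ℝ (Fin 3) → ℝ := fun g i x => fderiv ℝ g x (EuclideanSpace.single i 1); let P : EuclideanSpace ℝ (Fin 2) → EuclideanSpace ℝ (Fin 3) := fun y => WithLp.toLp 2 ![y 0, y 1, c]; (∫ y, (f (P y) / F (f (P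 y))) * w (P y) 2) = ν * (∫ y, D (D (fun x => F (f x)) 2) 2 (P y)) - ν * (∫ y, (ε ^ 2 / F (f (P y)) ^ 3) * (D f 0 (P y) ^ 2 + D f 1 (P y) ^ 2 + D f 2 (P y) ^ 2)) - (∫ y, u (P y) 2 * (ε ^ 2 / F (f (P y)) ^ 3) * (ω (P y) 0 * D f 0 (P y) + ω (P y) 1 * D f 1 (P y))) - ε ^ 2 * (∫ y, D (fun x => u x 2) 2 (P y) / F (f (P y)))

-- `FoldLawEps` holds: proved by `Summit.NavierStokesRegularity.NavierStokesRegularity.Theorems.slicedKelvin_foldLawEps_proof` (its module imports this route file, so no `_holds` link can be stated here).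

/-- item stmt-NavierStokesRegularity-15607 · support · rank 9 · closed · proved by Summit.NavierStokesRegularity.NavierStokesRegularity.Theorems.continuousAlignment_noBlowupToClay_proof @ 75b41afd0230 (prover) · by planner
sources: Fefferman2000, Leray1934, KNSS2009
[support] shared local-theory assembly (verbatim stmt-NavierStokesRegularity-0055, PROVED in tree by
Theorems.typeICertificateLadder_noBlowupToClay_proof): NoBlowup → Clay (A). [difficulty:
provable-now] -/
@[route_item "route-NavierStokesRegularity-SlicedKelvin"]
def NoBlowupToClay : Prop :=
  (∀ (ν T : ℝ), 0 < ν → 0 < T → ∀ (u : ℝ → EuclideanSpace ℝ (Fin 3) → EuclideanSpace ℝ (Fin 3)) (p : ℝ → EuclideanSpace ℝ (Fin 3) → ℝ), Literature.Analysis.FluidPDE.IsClassicalNSSolutionOn (Set.Ico 0 T) ν 0 u p → Literature.Analysis.FluidPDE.IsLerayHopfOn T ν 0 (u 0) u → Literature.Analysis.FluidPDE.HasRapidSpatialDecay (u 0) → Literature.Analysis.FluidPDE.HasSmoothExtensionPast ν 0 u T) → NavierStokesRegularity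

/-- `NoBlowupToClay` holds: proved by `Summit.NavierStokesRegularity.NavierStokesRegularity.Theorems.continuousAlignment_noBlowupToClay_proof` @ 75b41afd0230. -/
theorem NoBlowupToClay_holds : NoBlowupToClay := _root_.Summit.NavierStokesRegularity.NavierStokesRegularity.Theorems.continuousAlignment_noBlowupToClay_proof

/-- item stmt-NavierStokesRegularity-18238 · support · rank 9 · closed · proved by Summit.NavierStokesRegularity.NavierStokesRegularity.Theorems.slicedKelvin_slabApexBoundSuffices_proof (prover) · by planner
sources: Constantin1990, MajdaBertozzi2002, doi:10.1007/bf02096982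
[support] GLUE (provable now, one line) — the slab apex bound SUFFICES for the planar-flux a-priori
bound: SlabApexBound → PlanarFluxAPriori. This is the landed reduction of crux 2 along line Sketch
(card halfspace-apex-identity): Theorems/SlicedKelvinPlanarFluxAPrioriOfSlabApexBound.lean, theorem
Summit.NavierStokesRegularity.NavierStokesRegularity.Theorems.SlicedKelvinPlanarFluxAPriori.planarFluxAPriori_of_slabApexBound
(p161462; composition planarFluxAPriori_of_apexStubs with the five landed stubs fluxOfCubicDecay,
vorticityMassBound, apexLipschitz, slabSplit, decayPersistence: flux on [0,T/2] by decay persistence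
+ the kinematic cubic-decay flux bound, on [T/2,T) by the slab split Φ(c) ≤ ‖ω·n‖₁/(2h) + liminf_ε
τ^ε(S_h(c)) + Constantin's L¹ vorticity bound + the slab apex bound). `SlabApexBound` unfolds by
delta to that theorem's hypothesis and its conclusion is `PlanarFluxAPriori` BY NAME, so `theorem …
: SlicedKelvin.SlabApexBoundSuffices := fun h => planarFluxAPriori_of_slabApexBound h` closes this
item (kernel-checked in the repair planner's Glue.lean: lean check rc 0, 0 sorry, axioms
propext/Classical.choice/Quot.sound; attached as evidence). ROLE: the cone edge that connec -/
@[route_item "route-NavierStokesRegularity-SlicedKelvin"]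
def SlabApexBoundSuffices : Prop :=
  SlabApexBound → PlanarFluxAPriori

-- `SlabApexBoundSuffices` holds: proved by `Summit.NavierStokesRegularity.NavierStokesRegularity.Theorems.slicedKelvin_slabApexBoundSuffices_proof` (its module imports this route file, so no `_holds` link can be stated here).

/-- item stmt-NavierStokesRegularity-15608 · assembly · rank 1 · closed · proved by Summit.NavierStokesRegularity.NavierStokesRegularity.Theorems.slicedKelvin_assembly_proof (prover) · by planner
sources: Fefferman2000, KNSS2009
[assembly] PlanarFluxAPriori → PlanarFluxLiouville → FluxZoom → NoBlowupToClay →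
NavierStokesRegularity. -/
@[route_item "route-NavierStokesRegularity-SlicedKelvin"]
def Assembly : Prop :=
  PlanarFluxAPriori → PlanarFluxLiouville → FluxZoom → NoBlowupToClay → NavierStokesRegularity

-- `Assembly` holds: proved by `Summit.NavierStokesRegularity.NavierStokesRegularity.Theorems.slicedKelvin_assembly_proof` (its module imports this route file, so no `_holds` link can be stated here).

/-! D-0027 §2.1 — DECIDING THEOREM (planner-authored via `route open/edit --closes-file`; by planner-plan-novel-NavierStokesRegularity-Navie-a989c6c0-v2- 2026-08-16T15:51:10Z):
its hypotheses are this route's items and its conclusion the sub-problem Statement (glue_lint), and it elaborates with this file. -/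

@[closes "route-NavierStokesRegularity-SlicedKelvin"] theorem closes (h₁ : PlanarFluxAPriori) (h₂ : PlanarFluxLiouville) (h₃ : FluxZoom) :
    NavierStokesRegularity := by
  -- NoBlowupToClay (= stmt-NavierStokesRegularity-0055) is PROVED in tree; invoke it instead of assuming it.
  have h₄ : NoBlowupToClay :=
    _root_.Summit.NavierStokesRegularity.NavierStokesRegularity.Theorems.typeICertificateLadder_noBlowupToClay_proof
  apply h₄
  intro ν T hν hT u p hcl hLH hdec
  obtain ⟨M, hM⟩ := h₁ ν T hν hT u p hcl hLH hdec
  by_contra hne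
  obtain ⟨v, M', hv, hmeas, hsm, hflux, t, ht, hnc⟩ := h₃ ν T hν hT u p hcl hLH hdec hne ⟨M, hM⟩
  exact hnc (h₂ v hv hmeas hsm ⟨M', hflux⟩ t ht)

end Summit.NavierStokesRegularity.NavierStokesRegularity.Theses.SlicedKelvin
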